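import Summits.Ventures.HodgeRepro2.T5DecompositionTransport
import Summits.Ventures.HodgeRepro2.T5RestrictionRep
import Summits.Ventures.HodgeRepro2.T5SchurIsotypicSum

/-!
# T5SubrepTransport — subrepresentations of a closed stable subspace as subrepresentations of the
whole space: irreducibility and unitary equivalence transport along the inclusion

Cell pub-hodge-repro2, seat p5, Tier 5 (route/T5-N4-p5.md, N4.3 v13 (A3) STEP 1 – STEP 2: «L^{K_f}
= ⊕_{i=1}^{h} L²(Γ_i\G_∞) as unitary G_∞-modules … hence L^{K_f} = ⊕̂_π m_{K_f}(π) H_π with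
m_{K_f}(π) := Σ_i m(π, Γ_i) < ∞»).  To pass from the decompositions of the summands (rows 59 / 65 /
67 / 70) to a decomposition of the sum one needs the dictionary between subrepresentations of a
closed stable subspace `W ⊆ E` and subrepresentations of `E` inside `W`.  The restricted
representation itself is p1's `T5RestrictionRep.restrictRep π W hW : G →* (W →L[ℂ] W)` (with
p1's `T5CompleteReducibility.IsStable`, imported, nothing re-declared); p1's lane transports the
ALGEBRAIC irreducibility `IsIrreducibleSubspace`.  This file transports the CLOSED-subspace notions
of rows 49 / 53 (`IrreducibleOn`, `IsUnitaryEquiv`) used by [DE] Theorem 9.2.2: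

* for `U' : Submodule ℂ W`: `U'.map W.subtype ⊆ E` is closed (row 38's `isClosed_map_subtype`,
  imported) / stable / non-zero when `U'` is, and **`irreducibleOn_map_subtype`**: `IrreducibleOn (restrictRep ρ W hW) U'` ⇒
  `IrreducibleOn ρ (U'.map W.subtype)` (`comap W.subtype` of a closed stable
  `V ≤ U'.map W.subtype` is a closed stable subspace of `U'`; `Submodule.map_comap_subtype`);
* `mapSubtypeIso U' : U' ≃ₗᵢ[ℂ] U'.map W.subtype`, and **`isUnitaryEquiv_map_subtype`** /
  **`isUnitaryEquiv_of_map_subtype`**: unitary equivalence of stable subspaces transports along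
  the inclusion in BOTH directions;
* `IsUnitaryEquiv` is symmetric and transitive on stable subspaces (`isUnitaryEquiv_symm`,
  `isUnitaryEquiv_trans`).

Imports rows 38 / 49 / 53 / 60 (through `T5SchurIsotypicSum` / `T5DecompositionTransport`), p1's
`T5RestrictionRep` (p395172) and Mathlib.
Axioms: propext, Classical.choice, Quot.sound.
README §8(d): uses an L-value-free non-vanishing device: NO.
-/

namespace Summit.Ventures.HodgeRepro2.T5SubrepTransport

open Summit.Ventures.HodgeRepro2.T5CompactDiscreteDecomposition (IrreducibleOn)
open Summit.Ventures.HodgeRepro2.T5FiniteMultiplicity (IsUnitaryEquiv)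
open Summit.Ventures.HodgeRepro2.T5CompleteReducibility (IsStable)
open Summit.Ventures.HodgeRepro2.T5RestrictionRep (restrictRep coe_restrictRep_apply)
open Summit.Ventures.HodgeRepro2.T5SchurIsotypicSum (isClosed_map_subtype)
open scoped InnerProductSpace

variable {E : Type*} [NormedAddCommGroup E] [InnerProductSpace ℂ E] {G : Type*} [Group G]

variable {ρ : G →* (E →L[ℂ] E)} {W : Submodule ℂ E} {hW : IsStable ρ W}

/-! ### Subspaces of `W` as subspaces of `E` -/

/-- `U'.map W.subtype ≤ W`. -/
theorem map_subtype_le (U' : Submodule ℂ W) : U'.map W.subtype ≤ W :=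
  Submodule.map_subtype_le W U'

/-- Membership in `U'.map W.subtype`. -/
theorem mem_map_subtype {U' : Submodule ℂ W} {v : E} :
    v ∈ U'.map W.subtype ↔ ∃ u ∈ U', (u : E) = v :=
  Submodule.mem_map

/-- The image of a `restrictRep`-stable subspace is `ρ`-stable. -/
theorem stable_map_subtype {U' : Submodule ℂ W} (hU' : IsStable (restrictRep ρ W hW) U') :
    IsStable ρ (U'.map W.subtype) := by
  intro g v hv
  obtain ⟨u, hu, rfl⟩ := Submodule.mem_map.1 hv
  exact Submodule.mem_map.2 ⟨restrictRep ρ W hW g u, hU' g u hu, rfl⟩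

/-- The image of a non-zero subspace is non-zero. -/
theorem map_subtype_ne_bot {U' : Submodule ℂ W} (hU' : U' ≠ ⊥) : U'.map W.subtype ≠ ⊥ := by
  intro h
  apply hU'
  rw [Submodule.eq_bot_iff]
  intro u hu
  have hmem : (u : E) ∈ U'.map W.subtype := Submodule.mem_map.2 ⟨u, hu, rfl⟩
  rw [h, Submodule.mem_bot] at hmem
  exact Subtype.ext hmem

/-- A subspace of `E` below `U'.map W.subtype` pulls back below `U'`. -/
theorem comap_subtype_le {U' : Submodule ℂ W} {V : Submodule ℂ E} (hV : V ≤ U'.map W.subtype) :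
    V.comap W.subtype ≤ U' := by
  intro u hu
  obtain ⟨u', hu', h⟩ := Submodule.mem_map.1 (hV hu)
  have : u' = u := Subtype.ext h
  exact this ▸ hu'

/-- **Irreducibility transports along the inclusion** `W ⊆ E`: a `restrictRep`-irreducible
`U' ⊆ W` is `ρ`-irreducible as a subspace of `E`. -/
theorem irreducibleOn_map_subtype (hWc : IsClosed (W : Set E)) {U' : Submodule ℂ W}
    (hU' : IrreducibleOn (restrictRep ρ W hW) U') : IrreducibleOn ρ (U'.map W.subtype) := by
  obtain ⟨hc, hs, hne, hmin⟩ := hU'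
  refine ⟨isClosed_map_subtype hWc hc, stable_map_subtype hs, map_subtype_ne_bot hne, ?_⟩
  intro V hVle hVc hVs
  have h1 : V.comap W.subtype ≤ U' := comap_subtype_le hVle
  have h2 : IsClosed ((V.comap W.subtype : Submodule ℂ W) : Set W) :=
    hVc.preimage continuous_subtype_val
  have h3 : ∀ g, ∀ u ∈ V.comap W.subtype, restrictRep ρ W hW g u ∈ V.comap W.subtype :=
    fun g u hu => hVs g u hu
  rcases hmin _ h1 h2 h3 with h | h
  · left
    rw [Submodule.eq_bot_iff]
    intro v hv
    have hvW : v ∈ W := map_subtype_le U' (hVle hv)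
    have hmem : (⟨v, hvW⟩ : W) ∈ V.comap W.subtype := hv
    rw [h, Submodule.mem_bot] at hmem
    simpa using congrArg Subtype.val hmem
  · right
    rw [← h, Submodule.map_comap_subtype]
    exact (inf_eq_right.2 (hVle.trans (map_subtype_le U'))).symm

/-! ### Unitary equivalence along the inclusion -/

/-- The inclusion `U' ≃ₗᵢ U'.map W.subtype`. -/
noncomputable def mapSubtypeIso (U' : Submodule ℂ W) : U' ≃ₗᵢ[ℂ] U'.map W.subtype :=
  ⟨Submodule.equivMapOfInjective W.subtype W.subtype_injective U', fun u => by
    rw [Submodule.coe_norm, Submodule.coe_equivMapOfInjective_apply, Submodule.subtype_apply,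
      Submodule.coe_norm, Submodule.coe_norm]⟩

/-- `mapSubtypeIso` on vectors. -/
theorem coe_mapSubtypeIso_apply (U' : Submodule ℂ W) (u : U') :
    ((mapSubtypeIso U' u : U'.map W.subtype) : E) = (u : E) :=
  rfl

/-- `mapSubtypeIso.symm` on vectors. -/
theorem coe_mapSubtypeIso_symm_apply (U' : Submodule ℂ W) (v : U'.map W.subtype) :
    (((mapSubtypeIso U').symm v : U') : E) = (v : E) := by
  conv_rhs => rw [← (mapSubtypeIso U').apply_symm_apply v]
  rfl

/-- **Unitary equivalence transports along the inclusion**: `U₀' ≅ U'` as `restrictRep`-modules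
(`U₀'` stable) ⇒ `U₀'.map W.subtype ≅ U'.map W.subtype` as `ρ`-modules. -/
theorem isUnitaryEquiv_map_subtype {U₀' U' : Submodule ℂ W}
    (hU₀' : IsStable (restrictRep ρ W hW) U₀')
    (h : IsUnitaryEquiv (restrictRep ρ W hW) U₀' U') :
    IsUnitaryEquiv ρ (U₀'.map W.subtype) (U'.map W.subtype) := by
  obtain ⟨Φ, hΦ⟩ := h
  refine ⟨(mapSubtypeIso U₀').symm.trans (Φ.trans (mapSubtypeIso U')), fun g w hw => ?_⟩
  set u₀ : U₀' := (mapSubtypeIso U₀').symm w with hu₀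
  have hu₀E : (u₀ : E) = (w : E) := coe_mapSubtypeIso_symm_apply U₀' w
  have hmem : restrictRep ρ W hW g u₀ ∈ U₀' := hU₀' g u₀ u₀.2
  have hw' : (⟨ρ g w, hw⟩ : U₀'.map W.subtype) = mapSubtypeIso U₀' ⟨restrictRep ρ W hW g u₀, hmem⟩ :=
    Subtype.ext (by rw [coe_mapSubtypeIso_apply]; exact (congrArg (ρ g) hu₀E).symm)
  rw [hw']
  simp only [LinearIsometryEquiv.trans_apply, LinearIsometryEquiv.symm_apply_apply]
  rw [coe_mapSubtypeIso_apply, hΦ g u₀ hmem, coe_restrictRep_apply, coe_mapSubtypeIso_apply]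

/-- **Unitary equivalence descends along the inclusion**: `U₀'.map W.subtype ≅ U'.map W.subtype`
as `ρ`-modules (`U₀'` stable) ⇒ `U₀' ≅ U'` as `restrictRep`-modules. -/
theorem isUnitaryEquiv_of_map_subtype {U₀' U' : Submodule ℂ W}
    (hU₀' : IsStable (restrictRep ρ W hW) U₀')
    (h : IsUnitaryEquiv ρ (U₀'.map W.subtype) (U'.map W.subtype)) :
    IsUnitaryEquiv (restrictRep ρ W hW) U₀' U' := by
  obtain ⟨Φ, hΦ⟩ := h
  refine ⟨(mapSubtypeIso U₀').trans (Φ.trans (mapSubtypeIso U').symm), fun g u hu => ?_⟩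
  have hw : ρ g ((mapSubtypeIso U₀' u : U₀'.map W.subtype) : E) ∈ U₀'.map W.subtype := by
    rw [coe_mapSubtypeIso_apply]
    exact Submodule.mem_map.2 ⟨restrictRep ρ W hW g u, hU₀' g u u.2, rfl⟩
  have hu' : mapSubtypeIso U₀' ⟨restrictRep ρ W hW g u, hu⟩ =
      ⟨ρ g ((mapSubtypeIso U₀' u : U₀'.map W.subtype) : E), hw⟩ :=
    Subtype.ext rfl
  apply Subtype.ext
  simp only [LinearIsometryEquiv.trans_apply]
  rw [hu', coe_mapSubtypeIso_symm_apply, hΦ g (mapSubtypeIso U₀' u) hw, coe_restrictRep_apply,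
    coe_mapSubtypeIso_symm_apply]

/-! ### Symmetry and transitivity of unitary equivalence on stable subspaces -/

/-- `IsUnitaryEquiv` is symmetric on stable subspaces. -/
theorem isUnitaryEquiv_symm {U₀ U : Submodule ℂ E} (hU₀ : IsStable ρ U₀)
    (h : IsUnitaryEquiv ρ U₀ U) : IsUnitaryEquiv ρ U U₀ := by
  obtain ⟨Φ, hΦ⟩ := h
  refine ⟨Φ.symm, fun g u hu => ?_⟩
  set w : U₀ := Φ.symm u with hwdef
  have hmem : ρ g (w : E) ∈ U₀ := hU₀ g w w.2
  have h1 : Φ ⟨ρ g w, hmem⟩ = ⟨ρ g u, hu⟩ := by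
    apply Subtype.ext
    rw [hΦ g w hmem, hwdef, LinearIsometryEquiv.apply_symm_apply]
  rw [← h1, LinearIsometryEquiv.symm_apply_apply]

/-- `IsUnitaryEquiv` is transitive on stable subspaces. -/
theorem isUnitaryEquiv_trans {U₀ U₁ U₂ : Submodule ℂ E} (hU₁ : IsStable ρ U₁)
    (h₁ : IsUnitaryEquiv ρ U₀ U₁) (h₂ : IsUnitaryEquiv ρ U₁ U₂) : IsUnitaryEquiv ρ U₀ U₂ := by
  obtain ⟨Φ₁, hΦ₁⟩ := h₁
  obtain ⟨Φ₂, hΦ₂⟩ := h₂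
  refine ⟨Φ₁.trans Φ₂, fun g w hw => ?_⟩
  have hmem : ρ g ((Φ₁ w : U₁) : E) ∈ U₁ := hU₁ g _ (Φ₁ w).2
  have h1 : Φ₁ ⟨ρ g w, hw⟩ = ⟨ρ g (Φ₁ w : E), hmem⟩ := Subtype.ext (hΦ₁ g w hw)
  rw [LinearIsometryEquiv.trans_apply, h1, hΦ₂ g (Φ₁ w) hmem, LinearIsometryEquiv.trans_apply]

end Summit.Ventures.HodgeRepro2.T5SubrepTransport
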